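import Mathlib
import HarnessLib
import Summits.ResolutionOfSingularities.ResolutionOfSingularities.Theorems.WildQuotientsWildQuotientResolutionS1aQhSymAwayDatum

/-!
# S1a — R4c brick (i), ring data: the NORM 3-COVER of the two-moving-generator root over `L = k[x][1/hh]` at a common degree (`qs_ringData'`)

[OURS · L1 W4.5c · lead-1 g17; plan-1 RULING R-F15v, SPEC `Lines/s1a_logminvertex-R4c-SPEC.md` §1 (1O) COVER (pattern ✓`graphRoot_ringData'`): the cover
`y = (x₀^{n₀}, N(x₁)^{n₁}, N(x₂)^{n₂})` at `dbar = w₀n₀ = p·w₁·n₁ = p·w₂·n₂`, trace membership, `σ`-fixedness, cover elements `c₀ = u₀′^{n₀}`,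
`cⱼ = (∏_l (uⱼ′ + l·u₀′s^{w₀−wⱼ}))^{nⱼ}`, `hrad`, and on every chart the residual section `u₀′^{n₀}/cⱼ` (degree 0, in `𝔞·R_c`, `𝔞 = (aug σ_R : s^sh)` — it kills the
chart of `x₀` and confines `F` on the other two charts to `V(X₀′)`)] — NOT statements of the manuscript; counted 0; AI-level work, weaker than expert review.
Crux stmt-ResolutionOfSingularities-17941 `CyclicQuotientFourfolds`, line `s1a-logminvertex` v13 (`stub_reachLowerInFX`).
-/

set_option linter.dupNamespace false

noncomputable section

open Literature.AlgebraicGeometry.Resolution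
open scoped LaurentPolynomial
open MvPolynomial
open Summit.ResolutionOfSingularities.ResolutionOfSingularities.Theorems.WildQuotientResolution.S1
open Summit.ResolutionOfSingularities.ResolutionOfSingularities.Theorems.WildQuotientResolution.S1.CoarseChart
open Summit.ResolutionOfSingularities.ResolutionOfSingularities.Theorems.WildQuotientResolution.S1.NodeAway
open Summit.ResolutionOfSingularities.ResolutionOfSingularities.Theorems.WildQuotientResolution.S1.CentreAway
open Summit.ResolutionOfSingularities.ResolutionOfSingularities.Theorems.WildQuotientResolution.S1.BlowupCharts
open Summit.ResolutionOfSingularities.ResolutionOfSingularities.Theorems.WildQuotientResolution.S1.GameFrame.GModel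
open Summit.ResolutionOfSingularities.ResolutionOfSingularities.Theorems.WildQuotientResolution.S1.KillCert.QhAway

namespace Summit.ResolutionOfSingularities.ResolutionOfSingularities.Theorems.WildQuotientResolution.S1.KillCert.QhSym

variable {k : Type} [Field k] (σ : (MvPolynomial (Fin 4) k) ≃+* (MvPolynomial (Fin 4) k)) (hC : ∀ a : k, σ (C a) = C a)
  (h0 : σ (X 0) = X 0) (h1 : σ (X 1) = X 1 + X 0) (h2 : σ (X 2) = X 2 + X 0) (t₀ : (MvPolynomial (Fin 4) k)) (h3 : σ (X 3) = X 3 + t₀)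
  (w : Fin 3 → ℕ) (sh : ℕ) (hw1 : w 1 + sh ≤ w 0) (hw2 : w 0 = w 2 + sh)
  (ht₀ : t₀ ∈ (weightedFiltration (fun i => (X ((![0, 1, 2] : Fin 3 → Fin 4) i) : MvPolynomial (Fin 4) k)) w).ideal sh)
  (hh : (MvPolynomial (Fin 4) k)) (hσh : σ hh = hh)
  {p : ℕ} (hp : 0 < p) (hσpL : ∀ y : (Localization.Away hh), (⇑(sigmaAway σ hσh))^[p] y = y)
  (hσJ : ∀ n : ℕ, ((weightedFiltration (fun i => algebraMap (MvPolynomial (Fin 4) k) (Localization.Away hh) (X ((![0, 1, 2] : Fin 3 → Fin 4) i))) w).ideal n).map ((sigmaAway σ hσh) : (Localization.Away hh) →+* (Localization.Away hh)) ≤ (weightedFiltration (fun i => algebraMap (MvPolynomial (Fin 4) k) (Localization.Away hh) (X ((![0, 1, 2] : Fin 3 → Fin 4) i))) w).ideal n)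
  {mg : ℕ} (mo : Fin mg → ℕ) (𝒜 : (Π j : Fin mg, ZMod (mo j)) → AddSubgroup (Localization.Away hh)) [GradedRing 𝒜] (h𝒜 : ∀ x : (Localization.Away hh), x ∈ 𝒜 0)
  (hσp : ∀ a : (MvPolynomial (Fin 4) k), (⇑σ)^[p] a = a) (hh0 : hh ≠ 0)

set_option maxHeartbeats 4000000 in
include hC h0 h1 h2 h3 hw1 hw2 ht₀ hσp hh0 h𝒜 in
/-- ★★ **THE RING-LEVEL DATA OF THE TWO-MOVING-GENERATOR ROOT OVER `L` AT A COMMON DEGREE** `dbar = w₀n₀ = p·w₁n₁ = p·w₂n₂`. See the module docstring.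
[OURS · L1 W4.5c · R4c brick (i); NOT a statement of the manuscript] -/
theorem qs_ringData' [Fact p.Prime] [CharP k p] (dbar n₀ n₁ n₂ : ℕ) (hn₀ : 0 < n₀) (hn₁ : 0 < n₁) (hn₂ : 0 < n₂)
    (hd₀ : dbar = w 0 * n₀) (hd₁ : dbar = p * w 1 * n₁) (hd₂ : dbar = p * w 2 * n₂) :
    ∃ (y : Fin 3 → ↥(𝒜 0)) (hy : ∀ j, y j ∈ (traceFiltration 𝒜 (fun i => algebraMap (MvPolynomial (Fin 4) k) (Localization.Away hh) (X ((![0, 1, 2] : Fin 3 → Fin 4) i))) w).ideal dbar),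
      (∀ j, (sigmaAway σ hσh) (y j : (Localization.Away hh)) = y j) ∧
      ((y 0 : (Localization.Away hh)) = (fun i => algebraMap (MvPolynomial (Fin 4) k) (Localization.Away hh) (X ((![0, 1, 2] : Fin 3 → Fin 4) i))) 0 ^ n₀) ∧
      ((y 1 : (Localization.Away hh)) = (∏ i : ZMod p, ((fun i => algebraMap (MvPolynomial (Fin 4) k) (Localization.Away hh) (X ((![0, 1, 2] : Fin 3 → Fin 4) i))) 1 + (i.val : (Localization.Away hh)) * (fun i => algebraMap (MvPolynomial (Fin 4) k) (Localization.Away hh) (X ((![0, 1, 2] : Fin 3 → Fin 4) i))) 0)) ^ n₁) ∧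
      ((y 2 : (Localization.Away hh)) = (∏ i : ZMod p, ((fun i => algebraMap (MvPolynomial (Fin 4) k) (Localization.Away hh) (X ((![0, 1, 2] : Fin 3 → Fin 4) i))) 2 + (i.val : (Localization.Away hh)) * (fun i => algebraMap (MvPolynomial (Fin 4) k) (Localization.Away hh) (X ((![0, 1, 2] : Fin 3 → Fin 4) i))) 0)) ^ n₂) ∧
      coverElement 𝒜 (fun i => algebraMap (MvPolynomial (Fin 4) k) (Localization.Away hh) (X ((![0, 1, 2] : Fin 3 → Fin 4) i))) w dbar (y 0) (hy 0) = cobordantAlgebra.u' (fun i => algebraMap (MvPolynomial (Fin 4) k) (Localization.Away hh) (X ((![0, 1, 2] : Fin 3 → Fin 4) i))) w 0 ^ n₀ ∧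
      coverElement 𝒜 (fun i => algebraMap (MvPolynomial (Fin 4) k) (Localization.Away hh) (X ((![0, 1, 2] : Fin 3 → Fin 4) i))) w dbar (y 1) (hy 1) = (∏ i : ZMod p, (cobordantAlgebra.u' (fun i => algebraMap (MvPolynomial (Fin 4) k) (Localization.Away hh) (X ((![0, 1, 2] : Fin 3 → Fin 4) i))) w 1 + algebraMap (Localization.Away hh) ↥(cobordantAlgebra (fun i => algebraMap (MvPolynomial (Fin 4) k) (Localization.Away hh) (X ((![0, 1, 2] : Fin 3 → Fin 4) i))) w) (i.val : (Localization.Away hh)) * (cobordantAlgebra.u' (fun i => algebraMap (MvPolynomial (Fin 4) k) (Localization.Away hh) (X ((![0, 1, 2] : Fin 3 → Fin 4) i))) w 0 * cobordantAlgebra.s (fun i => algebraMap (MvPolynomial (Fin 4) k) (Localization.Away hh) (X ((![0, 1, 2] : Fin 3 → Fin 4) i))) w ^ (w 0 - w 1)))) ^ n₁ ∧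
      coverElement 𝒜 (fun i => algebraMap (MvPolynomial (Fin 4) k) (Localization.Away hh) (X ((![0, 1, 2] : Fin 3 → Fin 4) i))) w dbar (y 2) (hy 2) = (∏ i : ZMod p, (cobordantAlgebra.u' (fun i => algebraMap (MvPolynomial (Fin 4) k) (Localization.Away hh) (X ((![0, 1, 2] : Fin 3 → Fin 4) i))) w 2 + algebraMap (Localization.Away hh) ↥(cobordantAlgebra (fun i => algebraMap (MvPolynomial (Fin 4) k) (Localization.Away hh) (X ((![0, 1, 2] : Fin 3 → Fin 4) i))) w) (i.val : (Localization.Away hh)) * (cobordantAlgebra.u' (fun i => algebraMap (MvPolynomial (Fin 4) k) (Localization.Away hh) (X ((![0, 1, 2] : Fin 3 → Fin 4) i))) w 0 * cobordantAlgebra.s (fun i => algebraMap (MvPolynomial (Fin 4) k) (Localization.Away hh) (X ((![0, 1, 2] : Fin 3 → Fin 4) i))) w ^ (w 0 - w 2)))) ^ n₂ ∧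
      (∀ l : Fin 3, cobordantAlgebra.u' (fun i => algebraMap (MvPolynomial (Fin 4) k) (Localization.Away hh) (X ((![0, 1, 2] : Fin 3 → Fin 4) i))) w l ∈ (Ideal.span (Set.range fun j => coverElement 𝒜 (fun i => algebraMap (MvPolynomial (Fin 4) k) (Localization.Away hh) (X ((![0, 1, 2] : Fin 3 → Fin 4) i))) w dbar (y j) (hy j))).radical) ∧
      (∀ j : Fin 3,
        algebraMap ↥(cobordantAlgebra (fun i => algebraMap (MvPolynomial (Fin 4) k) (Localization.Away hh) (X ((![0, 1, 2] : Fin 3 → Fin 4) i))) w) (ChartRing 𝒜 (fun i => algebraMap (MvPolynomial (Fin 4) k) (Localization.Away hh) (X ((![0, 1, 2] : Fin 3 → Fin 4) i))) w dbar (y j) (hy j)) (cobordantAlgebra.u' (fun i => algebraMap (MvPolynomial (Fin 4) k) (Localization.Away hh) (X ((![0, 1, 2] : Fin 3 → Fin 4) i))) w 0 ^ n₀) * IsLocalization.Away.invSelf (coverElement 𝒜 (fun i => algebraMap (MvPolynomial (Fin 4) k) (Localization.Away hh) (X ((![0, 1, 2] : Fin 3 → Fin 4) i))) w dbar (y j)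 (hy j)) ∈ chartNodeGrading mo 𝒜 (fun i => algebraMap (MvPolynomial (Fin 4) k) (Localization.Away hh) (X ((![0, 1, 2] : Fin 3 → Fin 4) i))) w (fun _ => h𝒜 _) dbar (y j) (hy j) 0 ∧
        algebraMap ↥(cobordantAlgebra (fun i => algebraMap (MvPolynomial (Fin 4) k) (Localization.Away hh) (X ((![0, 1, 2] : Fin 3 → Fin 4) i))) w) (ChartRing 𝒜 (fun i => algebraMap (MvPolynomial (Fin 4) k) (Localization.Away hh) (X ((![0, 1, 2] : Fin 3 → Fin 4) i))) w dbar (y j) (hy j)) (cobordantAlgebra.u' (fun i => algebraMap (MvPolynomial (Fin 4) k) (Localization.Away hh) (X ((![0, 1, 2] : Fin 3 → Fin 4) i))) w 0 ^ n₀) * IsLocalization.Away.invSelf (coverElement 𝒜 (fun i => algebraMap (MvPolynomial (Fin 4) k) (Localization.Away hh) (X ((![0, 1, 2] : Fin 3 → Fin 4) i))) w dbar (y j) (hy j)) ∈ (((augmentationIdeal (sigmaR (sigmaAway σ hσh) (fun i => algebraMap (MvPolynomial (Fin 4) k) (Localization.Away hh) (X ((![0, 1, 2] : Fin 3 → Fin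 4) i))) w hσJ hp hσpL)).colon (Ideal.span {cobordantAlgebra.s (fun i => algebraMap (MvPolynomial (Fin 4) k) (Localization.Away hh) (X ((![0, 1, 2] : Fin 3 → Fin 4) i))) w ^ sh}))).map (algebraMap ↥(cobordantAlgebra (fun i => algebraMap (MvPolynomial (Fin 4) k) (Localization.Away hh) (X ((![0, 1, 2] : Fin 3 → Fin 4) i))) w) (ChartRing 𝒜 (fun i => algebraMap (MvPolynomial (Fin 4) k) (Localization.Away hh) (X ((![0, 1, 2] : Fin 3 → Fin 4) i))) w dbar (y j) (hy j)))) := by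
  classical
  haveI : NeZero p := ⟨(Fact.out : p.Prime).ne_zero⟩
  have hp1 : p ≠ 1 := (Fact.out : p.Prime).ne_one
  haveI : CharP (Localization.Away hh) p := qhl_charP hh hh0
  obtain ⟨r0, r1, r2, -⟩ := qsl_rows σ h0 h1 h2 t₀ h3 hh hσh
  have hw1' : w 1 ≤ w 0 := by omega
  have hw2' : w 2 ≤ w 0 := by omega
  -- the cover, kept opaque
  obtain ⟨cov, hcov⟩ : ∃ cov : Fin 3 → (Localization.Away hh), cov = ![(fun i => algebraMap (MvPolynomial (Fin 4) k) (Localization.Away hh) (X ((![0, 1, 2] : Fin 3 → Fin 4) i))) 0 ^ n₀, (∏ i : ZMod p, ((fun i => algebraMap (MvPolynomial (Fin 4) k) (Localization.Away hh) (X ((![0, 1, 2] : Fin 3 → Fin 4) i))) 1 + (i.val : (Localization.Away hh)) * (fun i => algebraMap (MvPolynomial (Fin 4) k) (Localization.Away hh) (X ((![0, 1, 2] : Fin 3 → Fin 4) i))) 0)) ^ n₁, (∏ i : ZMod p, ((fun i => algebraMap (MvPolynomial (Fin 4) k) (Localization.Away hh) (X ((![0, 1, 2] : Fin 3 → Fin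 4) i))) 2 + (i.val : (Localization.Away hh)) * (fun i => algebraMap (MvPolynomial (Fin 4) k) (Localization.Away hh) (X ((![0, 1, 2] : Fin 3 → Fin 4) i))) 0)) ^ n₂] := ⟨_, rfl⟩
  have hcov0 : cov 0 = (fun i => algebraMap (MvPolynomial (Fin 4) k) (Localization.Away hh) (X ((![0, 1, 2] : Fin 3 → Fin 4) i))) 0 ^ n₀ := by rw [hcov]; rfl
  have hcov1 : cov 1 = (∏ i : ZMod p, ((fun i => algebraMap (MvPolynomial (Fin 4) k) (Localization.Away hh) (X ((![0, 1, 2] : Fin 3 → Fin 4) i))) 1 + (i.val : (Localization.Away hh)) * (fun i => algebraMap (MvPolynomial (Fin 4) k) (Localization.Away hh) (X ((![0, 1, 2] : Fin 3 → Fin 4) i))) 0)) ^ n₁ := by rw [hcov]; rfl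
  have hcov2 : cov 2 = (∏ i : ZMod p, ((fun i => algebraMap (MvPolynomial (Fin 4) k) (Localization.Away hh) (X ((![0, 1, 2] : Fin 3 → Fin 4) i))) 2 + (i.val : (Localization.Away hh)) * (fun i => algebraMap (MvPolynomial (Fin 4) k) (Localization.Away hh) (X ((![0, 1, 2] : Fin 3 → Fin 4) i))) 0)) ^ n₂ := by rw [hcov]; rfl
  let y : Fin 3 → ↥(𝒜 0) := fun j => ⟨cov j, h𝒜 _⟩
  have hyval : ∀ j, (y j : (Localization.Away hh)) = cov j := fun _ => rfl
  have hy : ∀ j, y j ∈ (traceFiltration 𝒜 (fun i => algebraMap (MvPolynomial (Fin 4) k) (Localization.Away hh) (X ((![0, 1, 2] : Fin 3 → Fin 4) i))) w).ideal dbar := fun j => by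
    rw [mem_traceFiltration_iff, hyval]
    refine Fin.cases ?_ (Fin.cases ?_ (Fin.cases ?_ (fun l => l.elim0))) j
    · rw [hcov0]; exact QhAbs.qha_cover_zero_mem (fun i => algebraMap (MvPolynomial (Fin 4) k) (Localization.Away hh) (X ((![0, 1, 2] : Fin 3 → Fin 4) i))) w _ _ hd₀
    · change cov 1 ∈ _; rw [hcov1]; exact qs_cover_mem (fun i => algebraMap (MvPolynomial (Fin 4) k) (Localization.Away hh) (X ((![0, 1, 2] : Fin 3 → Fin 4) i))) w 1 hw1' (p := p) _ _ hd₁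
    · change cov 2 ∈ _; rw [hcov2]; exact qs_cover_mem (fun i => algebraMap (MvPolynomial (Fin 4) k) (Localization.Away hh) (X ((![0, 1, 2] : Fin 3 → Fin 4) i))) w 2 hw2' (p := p) _ _ hd₂
  have hσy : ∀ j, (sigmaAway σ hσh) (y j : (Localization.Away hh)) = y j := fun j => by
    rw [hyval]
    refine Fin.cases ?_ (Fin.cases ?_ (Fin.cases ?_ (fun l => l.elim0))) j
    · rw [hcov0]; exact QhAbs.qha_cover_zero_fixed (sigmaAway σ hσh) (fun i => algebraMap (MvPolynomial (Fin 4) k) (Localization.Away hh) (X ((![0, 1, 2] : Fin 3 → Fin 4) i))) r0 _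
    · change (sigmaAway σ hσh) (cov 1) = cov 1; rw [hcov1]; exact qs_cover_fixed (sigmaAway σ hσh) (fun i => algebraMap (MvPolynomial (Fin 4) k) (Localization.Away hh) (X ((![0, 1, 2] : Fin 3 → Fin 4) i))) 1 hp1 r0 r1 _
    · change (sigmaAway σ hσh) (cov 2) = cov 2; rw [hcov2]; exact qs_cover_fixed (sigmaAway σ hσh) (fun i => algebraMap (MvPolynomial (Fin 4) k) (Localization.Away hh) (X ((![0, 1, 2] : Fin 3 → Fin 4) i))) 2 hp1 r0 r2 _
  have hc0 := QhAbs.qha_coverElement_zero_eq (fun i => algebraMap (MvPolynomial (Fin 4) k) (Localization.Away hh) (X ((![0, 1, 2] : Fin 3 → Fin 4) i))) w mo 𝒜 (y 0) (hy 0) n₀ hd₀ (by rw [hyval, hcov0])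
  have hc1 := qs_coverElement_eq (fun i => algebraMap (MvPolynomial (Fin 4) k) (Localization.Away hh) (X ((![0, 1, 2] : Fin 3 → Fin 4) i))) w 1 hw1' mo 𝒜 (y 1) (hy 1) n₁ hd₁ (by rw [hyval, hcov1])
  have hc2 := qs_coverElement_eq (fun i => algebraMap (MvPolynomial (Fin 4) k) (Localization.Away hh) (X ((![0, 1, 2] : Fin 3 → Fin 4) i))) w 2 hw2' mo 𝒜 (y 2) (hy 2) n₂ hd₂ (by rw [hyval, hcov2])
  have hrad : ∀ l : Fin 3, cobordantAlgebra.u' (fun i => algebraMap (MvPolynomial (Fin 4) k) (Localization.Away hh) (X ((![0, 1, 2] : Fin 3 → Fin 4) i))) w l ∈ (Ideal.span (Set.range fun j => coverElement 𝒜 (fun i => algebraMap (MvPolynomial (Fin 4) k) (Localization.Away hh) (X ((![0, 1, 2] : Fin 3 → Fin 4) i))) w dbar (y j) (hy j))).radical := fun l =>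
    qs_hrad (fun i => algebraMap (MvPolynomial (Fin 4) k) (Localization.Away hh) (X ((![0, 1, 2] : Fin 3 → Fin 4) i))) w (p := p) (fun j => coverElement 𝒜 (fun i => algebraMap (MvPolynomial (Fin 4) k) (Localization.Away hh) (X ((![0, 1, 2] : Fin 3 → Fin 4) i))) w dbar (y j) (hy j)) hn₁ hn₂ (w 0 - w 1) (w 0 - w 2) hc0 hc1 hc2 l
  -- the residual ideal `𝔞 ∋ u₀′`
  have hmem0 : cobordantAlgebra.u' (fun i => algebraMap (MvPolynomial (Fin 4) k) (Localization.Away hh) (X ((![0, 1, 2] : Fin 3 → Fin 4) i))) w 0 ∈ ((augmentationIdeal (sigmaR (sigmaAway σ hσh) (fun i => algebraMap (MvPolynomial (Fin 4) k) (Localization.Away hh) (X ((![0, 1, 2] : Fin 3 → Fin 4) i))) w hσJ hp hσpL)).colon (Ideal.span {cobordantAlgebra.s (fun i => algebraMap (MvPolynomial (Fin 4) k) (Localization.Away hh) (X ((![0, 1, 2] : Fin 3 → Fin 4) i))) w ^ sh})) :=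
    (qsl_residual σ hC h0 h1 h2 t₀ h3 w sh hw1 hw2 ht₀ hh hσh hp hσp hσJ).2.1
  refine ⟨y, hy, hσy, hcov0, hcov1, hcov2, hc0, hc1, hc2, hrad, fun j => ?_⟩
  exact QhAbs.qha_residualSection_zero (fun i => algebraMap (MvPolynomial (Fin 4) k) (Localization.Away hh) (X ((![0, 1, 2] : Fin 3 → Fin 4) i))) w mo 𝒜 (fun _ => h𝒜 _) (y j) (hy j) n₀ hd₀ _ hmem0 hn₀

end Summit.ResolutionOfSingularities.ResolutionOfSingularities.Theorems.WildQuotientResolution.S1.KillCert.QhSym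

end
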